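import Literature.AlgebraicGeometry.HodgeTheory.ProjectiveSubquotientZeroCriterion
import Literature.Algebra.Homology.LaurentCechGradedModuleGlobalSections
import HarnessLib

/-!
# `M̄_d ↪ Γ(M~(d))`: lower bound for global sections; `H⁰(X, 𝒪_X(d)) ≠ 0` for `X ≠ ∅`, `d ≥ 0`

Hartshorne, *Algebraic Geometry*, II Ex. 5.9 (a) and Ex. 5.10: for a graded module `M = F_e ⧸ K` the
natural map `α_d : M_d → Γ(ℙ^r, M~(d))` has kernel `(K̄ ⧸ K)_d` (`K̄` the saturation;
`LaurentCechGradedModuleGlobalSections.ker_alphaH0`). Hence, over a field: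

* **`LaurentCech.finrank_le_finrank_homology_quot_zero_add`** —
  `dim (F_e)_d ≤ h⁰(Č_d(F_e ⧸ K)) + dim K̄_d`, i.e. **`h⁰(Č_d(M)) ≥ dim (F_e)_d - dim K̄_d = dim (F_e ⧸ K̄)_d`**
  for EVERY twist `d` (equality for `d ≫ 0` is `exists_forall_nonempty_quotient_degPiece_linearEquiv_homology_zero`);
* `LaurentCech.degPiece_sat_ne_top_of_sat_ne_top` — for a homogeneous ideal `I ⊊ P` with
  `Ī ≠ P`, `Ī_d ≠ P_d` for every `d ≥ 0` (if all `x_i^d ∈ Ī` then `1 ∈ Ī`);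
* **`LaurentCech.one_le_finrank_homology_quot_zero_of_sat_ne_top`** — **`h⁰(Č_d(P ⧸ I)) ≥ 1` for all
  `d ≥ 0` when `Ī ≠ P`**, i.e. `H⁰(X, 𝒪_X(d)) ≠ 0` for the non-empty closed subscheme `X = V(I) ⊆ ℙ^r`
  (`d = 0`: the constant section `1`); with `ProjectiveSubquotientZeroCriterion` (`Ī = P ⟺ P_X = 0`):
  `LaurentCech.one_le_finrank_homology_quot_zero_of_hilbertPolynomial_ne_zero`.

## References

* [Hartshorne1977] R. Hartshorne, *Algebraic Geometry*, GTM 52, Springer 1977, II Prop. 5.13 (p. 118),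
  II Ex. 5.9 (a), Ex. 5.10 (a), (b) (p. 125), III Ex. 5.5 (p. 231).
-/

noncomputable section

open CategoryTheory CategoryTheory.Limits Polynomial

universe u

namespace Literature.Algebra.Homology

namespace LaurentCech

open OrderedCech TopCohomology

variable {k : Type u} [Field k] {r : ℕ} {J : Type} [Fintype J] (e : J → ℤ)

/-- **`dim (F_e)_d ≤ h⁰(Č_d(F_e ⧸ K)) + dim K̄_d`** (`K` graded, `k` a field, `r ≥ 1`, every `d`): the
map `α_d : (F_e)_d → H⁰(Č_d(F_e ⧸ K))` has kernel exactly `K̄_d` (II Ex. 5.9 (a), Ex. 5.10), so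
`(F_e)_d ⧸ K̄_d` embeds into the global sections. [cite: Hartshorne1977, II Ex. 5.9 (a) (p. 125)]
[cite: Hartshorne1977, II Ex. 5.10 (p. 125)] -/
theorem finrank_le_finrank_homology_quot_zero_add (hr : 1 ≤ r) {K : Submodule (P k r) (J → P k r)}
    (hK : IsGraded e K) (d : ℤ) :
    Module.finrank k (∀ j, (Ldeg k r (d - e j)).comap (toL k r).toLinearMap) ≤
      Module.finrank k ((quot e K d).homology 0) + Module.finrank k (degPiece e (sat K) d) := by
  haveI : ∀ j, Module.Finite k ((Ldeg k r (d - e j)).comap (toL k r).toLinearMap) := fun j =>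
    moduleFinite_comap_toL_Ldeg _
  haveI : Module.Finite k ((quot e K d).homology 0) := moduleFinite_homology_quot e hK d 0
  have h1 := LinearMap.finrank_range_add_finrank_ker (alphaH0 e K hr d)
  rw [ker_alphaH0] at h1
  have h2 := Submodule.finrank_le (LinearMap.range (alphaH0 e K hr d))
  omega

/-- **If `Ī ≠ P` then `Ī_d ≠ P_d` for every `d ≥ 0`** (`I ⊆ P = k[x_0, …, x_r]` any submodule,
`J = Unit`, `e = 0`): were all `x_i^d` in `Ī`, then `1 ∈ Ī` (`x_i^{n_i} · x_i^d ∈ I`), so `Ī = P`.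
[cite: Hartshorne1977, II Ex. 5.10 (a) (p. 125)] -/
theorem degPiece_sat_ne_top_of_sat_ne_top {I : Submodule (P k r) (Unit → P k r)} (hX : sat I ≠ ⊤)
    {d : ℤ} (hd : 0 ≤ d) : degPiece (fun _ : Unit => (0 : ℤ)) (sat I) d ≠ ⊤ := by
  intro htop
  apply hX
  -- every `x_i^d` lies in `Ī`
  have hxi : ∀ i : Fin (r + 1), (fun _ : Unit => (MvPolynomial.X i ^ d.toNat : P k r)) ∈ sat I := by
    intro i
    have hmem : toL k r (MvPolynomial.X i ^ d.toNat : P k r) ∈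
        Ldeg k r (d - (fun _ : Unit => (0 : ℤ)) ()) := by
      have h := toL_X_pow_mem_Ldeg (A := k) (r := r) i d.toNat
      rw [Int.toNat_of_nonneg hd] at h
      simpa only [sub_zero] using h
    have hq : (fun _ : Unit => (⟨MvPolynomial.X i ^ d.toNat, hmem⟩ :
        (Ldeg k r (d - (fun _ : Unit => (0 : ℤ)) ())).comap (toL k r).toLinearMap)) ∈
        degPiece (fun _ : Unit => (0 : ℤ)) (sat I) d := by
      rw [htop]; exact Submodule.mem_top
    exact (mem_degPiece _ _).1 hq
  -- hence `1 ∈ Ī`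
  have hone : (fun _ : Unit => (1 : P k r)) ∈ sat I := by
    rw [mem_sat]
    intro i
    obtain ⟨n, hn⟩ := (mem_sat I).1 (hxi i) i
    refine ⟨n + d.toNat, ?_⟩
    have heq : (MvPolynomial.X i ^ (n + d.toNat) : P k r) • (fun _ : Unit => (1 : P k r)) =
        (MvPolynomial.X i ^ n : P k r) • (fun _ : Unit => (MvPolynomial.X i ^ d.toNat : P k r)) := by
      funext u
      simp only [Pi.smul_apply, smul_eq_mul, mul_one, pow_add]
    rw [heq]
    exact hn
  rw [eq_top_iff]
  intro w _
  have hw : w = (w ()) • (fun _ : Unit => (1 : P k r)) := by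
    funext u
    rw [Pi.smul_apply, smul_eq_mul, mul_one]
  rw [hw]
  exact (sat I).smul_mem _ hone

/-- **`h⁰(Č_d(P ⧸ I)) ≥ 1` for every `d ≥ 0` when `Ī ≠ P`**: a non-empty closed subscheme
`X = V(I) ⊆ ℙ^r_k` has `H⁰(X, 𝒪_X(d)) ≠ 0` for all `d ≥ 0` (for `d = 0`: the constant section `1`);
`I` graded, `r ≥ 1`. [cite: Hartshorne1977, II Ex. 5.10 (p. 125)]
[cite: Hartshorne1977, II Prop. 5.13 (p. 118)] -/
theorem one_le_finrank_homology_quot_zero_of_sat_ne_top (hr : 1 ≤ r)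
    {I : Submodule (P k r) (Unit → P k r)} (hI : IsGraded (fun _ : Unit => (0 : ℤ)) I)
    (hX : sat I ≠ ⊤) {d : ℤ} (hd : 0 ≤ d) :
    1 ≤ Module.finrank k ((quot (fun _ : Unit => (0 : ℤ)) I d).homology 0) := by
  haveI : ∀ j : Unit, Module.Finite k
      ((Ldeg k r (d - (fun _ : Unit => (0 : ℤ)) j)).comap (toL k r).toLinearMap) := fun j =>
    moduleFinite_comap_toL_Ldeg _
  have h1 := finrank_le_finrank_homology_quot_zero_add (fun _ : Unit => (0 : ℤ)) hr hI d
  have h2 := Submodule.finrank_lt (degPiece_sat_ne_top_of_sat_ne_top (k := k) (r := r) hX hd)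
  omega

/-- **`P_X ≠ 0 ⟹ H⁰(X, 𝒪_X(d)) ≠ 0` for all `d ≥ 0`** (`X = V(I) ⊆ ℙ^r_k`, `I` graded, `r ≥ 1`):
`P_X ≠ 0` says `Ī ≠ P` (`ProjectiveSubquotientZeroCriterion.top_le_sat_iff_hilbertPolynomial_eq_zero`).
[cite: Hartshorne1977, II Ex. 5.10 (p. 125)] [cite: Hartshorne1977, III Ex. 5.2 (p. 230)] -/
theorem one_le_finrank_homology_quot_zero_of_hilbertPolynomial_ne_zero (hr : 1 ≤ r)
    {I : Submodule (P k r) (Unit → P k r)} (hI : IsGraded (fun _ : Unit => (0 : ℤ)) I) {Q : ℚ[X]}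
    (hQ : ∀ n : ℤ, ((∑ q ∈ Finset.range (r + 1), (-1 : ℤ) ^ q *
      (Module.finrank k ((quot (fun _ : Unit => (0 : ℤ)) I n).homology q) : ℤ) : ℤ) : ℚ) =
        Q.eval (n : ℚ))
    (hQ0 : Q ≠ 0) {d : ℤ} (hd : 0 ≤ d) :
    1 ≤ Module.finrank k ((quot (fun _ : Unit => (0 : ℤ)) I d).homology 0) :=
  one_le_finrank_homology_quot_zero_of_sat_ne_top hr hI
    (fun htop => hQ0 ((top_le_sat_iff_hilbertPolynomial_eq_zero _ hr hI hQ).1 htop.ge)) hd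

end LaurentCech

end Literature.Algebra.Homology

end
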